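import Summits.BirchSwinnertonDyer.BirchSwinnertonDyer.Theorems.SchneiderFreeAdditiveX3PotMultLogDescent
import Literature.NumberTheory.EllipticCurves.UnrIntegersUnits
import HarnessLib
import HarnessLib.Audit.Tags

/-!
# Route `SchneiderFreeAdditiveX3` (K1 door), crux `PotMultBranchIMC` (stmt-BirchSwinnertonDyer-19176):
# the DESCENDED COFACTOR in `R₀` — from a Castella–Hsieh-shaped conductor-`p` value on the partner to the
# value clause of `PotMultRead.KYCHMOrientedX3`, cofactor integral / unit BY CONSTRUCTION

Cell `bsd-schneider-ideate` (HOME `run/shared/lean/pub/bsd-schneider-ideate/`), seat `door-c2` gen 11.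
PARTITION: board row B6 ∩ X3 ∩ sst-twist, `r = 1`, (M) half (X3 ∧ (M), 4 541 of 7 101 pairs) of
`Rank1Residual.partition`; types-the-object-of the cofactor bookkeeping between a print-shaped conductor-`p`
value formula for the MULTIPLICATIVE partner and the (M) research stub; closes nothing (BSD not advanced).

Companion of `…PotMultLogDescent.lean` (the identity `(log_{ω_V} j_* z)² = p*·(u_{C₂}u_D)⁻²·(log_{ω_W} Q)²`
on the door with the partner semistable at `p`). Here `F = ℂ_p`, `e = algebraMap ℚ_p ℂ_p`:

* §1 `exists_padicInt_descendedCofactor` — for a rational `p`-adic unit `q` the descended constant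
  `p⁻¹ · p* · q⁻²` IS (the image of) a unit `r = (−1)^{(p−1)/2} q⁻² ∈ ℤ_p^×`; `isUnit_toUnr_of_norm_eq_one`.
* §2 `exists_cofactor_hasValueAt_descended_of_partner` — at one door datum (partner `V` with
  `Good V p ∨ Mult V p`, presentation `W = C₂ • ((D • V) ⊗ χ_{p*})`, `θ² = p*` in `L ⊇ K`, `z ∈ V(L)` descending
  to `Q ∈ W(K)`, `j : L → ℂ_p` over `ι_p`): a value clause in the SHAPE PRINTED BY CASTELLA–HSIEH (Math. Ann.
  370 (2018) Thm. 5.7; typed for the good cell as `castellaHsieh2018_branchValue_conductorP`)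
  `L(0) = u₀ · p⁻¹ · (log_{ω_V}(j_* z) / c)²`, `u₀ ∈ R₀`, yields the clause of `PotMultRead.KYCHMOrientedX3` /
  `KYCHMUnitOriented`: `L(0) = u · (log_{ω_W} Q / c)²` (`log_{ω_W} Q = logOmega W p ι_p Q ∈ ℚ_p` read in `ℂ_p`)
  with `u = u₀ · r ∈ R₀` and `u` a UNIT iff `u₀` is. So IF a conductor-`p` value formula for the multiplicative
  partner is ever printed in that shape (none is — door-c2 «find» ×11; Keller–Yin arXiv:2410.23241 p. 15 names
  the case open), the value half of the (M) stub (lower: integral cofactor; upper: unit cofactor) follows BY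
  NAME; any other printed cofactor `A` is handled by `partnerValue_eq_descendedValue_of_semistable`.

HONEST FRAMING: bookkeeping theorems about a change of variables and the subring `R₀ ⊂ ℂ_p`; nothing is
asserted about `p`-adic `L`-functions; the crux stays OPEN. Theses-free; theorems only; standard axioms.

References: Castella–Hsieh, Math. Ann. 370 (2018) Thm. 5.7, Lemma 5.4 (shape of the conductor-`p` value);
Castella, Camb. J. Math. 6 (2018) §3 (the ring `R₀`); Silverman *AEC* VII.1 (minimal models).
-/

noncomputable section

open scoped Classical

open WeierstrassCurve NumberField IsDedekindDomain Field
  Literature.NumberTheory.EllipticCurves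
  Literature.NumberTheory.EllipticCurves.FormalGroupChart
  Literature.NumberTheory.EllipticCurves.Rank1Residual
  Summit.BirchSwinnertonDyer.Rank1Residual
  Summit.BirchSwinnertonDyer.Rank1Residual.X11b
  Summit.BirchSwinnertonDyer.Rank1Residual.X11b.Halves
  Summit.BirchSwinnertonDyer.BirchSwinnertonDyer.Theorems.SchneiderFree.KYRead.LogDescent

set_option linter.dupNamespace false
set_option autoImplicit false

namespace Summit.BirchSwinnertonDyer.BirchSwinnertonDyer.Theorems.SchneiderFree.PotMultRead.LogDescent

variable {p : ℕ} [Fact p.Prime]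

/-! ## §1 The descended constant is a unit of `ℤ_p`, read in `R₀` -/

/-- A `p`-adic integer of norm one, read in `R₀` along `ℤ_p → R₀`, is a unit of `R₀`
(`unrIntegers.isUnit_iff_norm_eq_one`). [cite: Castella2018, §3 (p. 9) (the ring R₀)] -/
theorem isUnit_toUnr_of_norm_eq_one (x : ℤ_[p]) (hx : ‖(x : ℚ_[p])‖ = 1) : IsUnit (toUnr p x) := by
  rw [unrIntegers.isUnit_iff_norm_eq_one, coe_toUnr, norm_algebraMap', hx]

/-- **The descended constant is a `p`-adic unit:** for `q ∈ ℚ` with `‖q‖_p = 1`,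
`p⁻¹ · p* · q⁻² = ι(r)` in `ℂ_p` for the `p`-adic integer `r = (−1)^{(p−1)/2} · q⁻²` of norm one
(`p* = (−1)^{(p−1)/2} p`, so `p⁻¹ · p* = ±1`). [cite: SilvermanAEC2009, VII.1 (u of a change between minimal models)] -/
theorem exists_padicInt_descendedCofactor {q : ℚ} (hq : ‖(q : ℚ_[p])‖ = 1) :
    ∃ r : ℤ_[p], ‖(r : ℚ_[p])‖ = 1 ∧
      algebraMap ℚ_[p] ℂ_[p] (r : ℚ_[p]) =
        (p : ℂ_[p])⁻¹ * (algebraMap ℚ ℂ_[p] ((-1 : ℚ) ^ (p / 2) * p) *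
          ((algebraMap ℚ ℂ_[p] q)⁻¹) ^ 2) := by
  have hp : p.Prime := Fact.out
  have hq0 : q ≠ 0 := by
    rintro rfl
    rw [Rat.cast_zero, norm_zero] at hq
    exact zero_ne_one hq
  have hnorm : ‖(((-1 : ℚ) ^ (p / 2) * (q⁻¹) ^ 2 : ℚ) : ℚ_[p])‖ = 1 := by
    rw [Rat.cast_mul, Rat.cast_pow, Rat.cast_pow, Rat.cast_inv, Rat.cast_neg, Rat.cast_one, norm_mul,
      norm_pow, norm_pow, norm_inv, norm_neg, norm_one, hq]
    simp
  refine ⟨⟨(((-1 : ℚ) ^ (p / 2) * (q⁻¹) ^ 2 : ℚ) : ℚ_[p]), hnorm.le⟩, hnorm, ?_⟩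
  have hpC : (p : ℂ_[p]) ≠ 0 := Nat.cast_ne_zero.mpr hp.ne_zero
  have hqC : (q : ℂ_[p]) ≠ 0 := by exact_mod_cast hq0
  change algebraMap ℚ_[p] ℂ_[p] ((((-1 : ℚ) ^ (p / 2) * (q⁻¹) ^ 2 : ℚ)) : ℚ_[p]) = _
  rw [map_ratCast, eq_ratCast, eq_ratCast]
  push_cast
  field_simp

/-! ## §2 From a Castella–Hsieh-shaped partner-side value to the stub's descended clause, cofactor in `R₀` -/

variable (V : WeierstrassCurve ℚ) [V.IsElliptic] [V.IsGloballyMinimal] (D C₂ : VariableChange ℚ)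
  [(D • V).IsCharNeTwoNF]
  [(C₂ • (D • V).quadraticTwist ((-1 : ℚ) ^ (p / 2) * p)).IsElliptic]
  [(C₂ • (D • V).quadraticTwist ((-1 : ℚ) ^ (p / 2) * p)).IsGloballyMinimal]
  {K : Type} [Field K] [NumberField K] {L : Type*} [Field L] [Algebra ℚ L] [Algebra K L]

/-- **Print-shaped value on the partner ⟹ the (M)/(G) stub's value clause, cofactor in `R₀`, unit iff unit.**
At one door datum with the partner `V` semistable at `p` (`Good V p ∨ Mult V p`, `p ≠ 2`), presentation
`W = C₂ • ((D • V) ⊗ χ_{p*})`, `θ² = p*` in `L ⊇ K`, `z ∈ V(L)` with descent `Q ∈ W(K)`, `ι_p : K → ℚ_p` and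
`j : L → ℂ_p` with `j|_K = ι_p` (read in `ℂ_p`): if `L ∈ R₀⟦T⟧` has the value
`L(0) = u₀ · p⁻¹ · (log_{ω_V}(j_* z) / c)²` (the shape of Castella–Hsieh 2018 Thm. 5.7 at a conductor-`p`
character; `u₀ ∈ R₀`, `c ∈ ℤ` the partner's parametrisation constant), then
`L(0) = u · (log_{ω_W} Q / c)²` in the descended currency of `PotMultRead.KYCHMOrientedX3` / `KYCHMUnitOriented`,
with `u = u₀ · (−1)^{(p−1)/2}(u_{C₂}u_D)⁻² ∈ R₀`, and `u` is a unit of `R₀` IFF `u₀` is. On the (M) cell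
(`Mult V p`) this is the by-name bridge a future printed conductor-`p` value formula at `p ∥ N_V` would use
(none is in print); on the (G-ord) cell it is door-c3 gen 10's descent with the cofactor made explicit.
[cite: CastellaHsieh2018, Thm. 5.7 and Lemma 5.4 (shape of the value)] [cite: SilvermanAEC2009, VII.1] -/
theorem exists_cofactor_hasValueAt_descended_of_partner (hp2 : p ≠ 2) (hV : Good V p ∨ Mult V p)
    {θ : L} (hθ2 : θ ^ 2 = algebraMap ℚ L ((-1 : ℚ) ^ (p / 2) * p)) (hθ : θ ≠ 0)
    (z : (V.baseChange L).toAffine.Point)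
    (Q : ((C₂ • (D • V).quadraticTwist ((-1 : ℚ) ^ (p / 2) * p)).baseChange K).toAffine.Point)
    (hQ : WeierstrassCurve.Affine.Point.map (algebraMap K L).toRatAlgHom Q =
      VariableChange.pointEquivBaseChange ((D • V).quadraticTwist ((-1 : ℚ) ^ (p / 2) * p)) C₂ L
        ((VariableChange.pointEquiv (((D • V).quadraticTwist
            ((-1 : ℚ) ^ (p / 2) * p)).baseChange L) (untwistAt hθ)).symm
          ((Affine.Point.congrEquiv (untwistAt_smul_eq (D • V) hθ2 hθ)).symm
            (VariableChange.pointEquivBaseChange V D L z))))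
    (ι_p : K →+* ℚ_[p]) (j : L →+* ℂ_[p])
    (hj : ∀ x : K, j (algebraMap K L x) = algebraMap ℚ_[p] ℂ_[p] (ι_p x))
    [(V.baseChange ℂ_[p]).IsIntegral (NormedField.valuation (K := ℂ_[p])).integer]
    (Ls : UnrSeries p) (u₀ : unrIntegers p) (c : ℤ)
    (h : Ls.HasValueAt 0 (((u₀ : unrIntegers p) : ℂ_[p]) * ((p : ℂ_[p]))⁻¹ *
      (padicLogPointFiniteExt (NormedField.valuation (K := ℂ_[p])) (V.baseChange ℂ_[p]) p
          (WeierstrassCurve.Affine.Point.map j.toRatAlgHom z) / (c : ℂ_[p])) ^ 2)) :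
    ∃ u : unrIntegers p, (IsUnit u ↔ IsUnit u₀) ∧
      Ls.HasValueAt 0 (((u : unrIntegers p) : ℂ_[p]) *
        (algebraMap ℚ_[p] ℂ_[p] (logOmega (C₂ • (D • V).quadraticTwist ((-1 : ℚ) ^ (p / 2) * p)) p ι_p Q /
          (c : ℚ_[p]))) ^ 2) := by
  -- the descended constant `r = ± (u_{C₂}u_D)⁻² ∈ ℤ_p^×`
  obtain ⟨r, hr1, hr⟩ := exists_padicInt_descendedCofactor (p := p)
    (norm_presentationU_eq_one_of_semistable V D C₂ hp2 hV)
  refine ⟨u₀ * toUnr p r, ?_, ?_⟩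
  · rw [IsUnit.mul_iff, and_iff_left (isUnit_toUnr_of_norm_eq_one r hr1)]
  · -- rewrite the partner-side value through the descent identity (F = ℂ_p, e = algebraMap)
    have he : ∀ x : ℚ_[p], ‖algebraMap ℚ_[p] ℂ_[p] x‖ = ‖x‖ := fun x ↦ norm_algebraMap' ℂ_[p] x
    have hc : ((c : ℂ_[p])) = algebraMap ℚ_[p] ℂ_[p] (c : ℚ_[p]) := by rw [map_intCast]
    have key := partnerValue_eq_descendedValue_of_semistable V D C₂ hp2 hV hθ2 hθ z Q hQ ι_p
      (algebraMap ℚ_[p] ℂ_[p]) he j hj (((u₀ : unrIntegers p) : ℂ_[p]) * ((p : ℂ_[p]))⁻¹) (c : ℚ_[p])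
    have e2 : ((u₀ : unrIntegers p) : ℂ_[p]) * ((p : ℂ_[p]))⁻¹ *
        algebraMap ℚ ℂ_[p] ((-1 : ℚ) ^ (p / 2) * p) * ((algebraMap ℚ ℂ_[p] (C₂.u * D.u : ℚ))⁻¹) ^ 2 =
        ((u₀ * toUnr p r : unrIntegers p) : ℂ_[p]) := by
      rw [Subring.coe_mul, coe_toUnr, hr]; ring
    rw [hc, key, e2] at h
    exact h

end Summit.BirchSwinnertonDyer.BirchSwinnertonDyer.Theorems.SchneiderFree.PotMultRead.LogDescent

end
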